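import Mathlib.Analysis.Normed.Algebra.Exponential
import Mathlib.Analysis.SpecialFunctions.Exponential
import Mathlib.Analysis.SpecificLimits.Basic
import Mathlib.Tactic.NoncommRing
import HarnessLib

/-!
# The Lie product formula in a Banach algebra

Trunk T-QLATTICE (matrix analysis behind the quantum-lattice statements; consumer: the
Golden–Thompson and Bernstein trace inequalities used in the Koma–Tasaki bound
`Literature.MathematicalPhysics.QuantumLattice.koma_tasaki_2d`).

For a complete normed algebra `𝔸` over `𝕂 = ℝ` or `ℂ` with `‖1‖ = 1` we prove, with explicit
constants,

* `norm_exp_le`: `‖exp a‖ ≤ e^{‖a‖}`;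
* `norm_exp_sub_one_sub_le`: `‖exp a - 1 - a‖ ≤ ‖a‖² e^{‖a‖}`;
* `norm_exp_mul_exp_sub_exp_add_le`: `‖exp x exp y - exp (x + y)‖ ≤ 6 (‖x‖ + ‖y‖)² e^{4(‖x‖ + ‖y‖)}`;
* `norm_pow_sub_pow_le'`: `‖X^{N+1} - Y^{N+1}‖ ≤ (N + 1) M^N ‖X - Y‖` if `‖X‖, ‖Y‖ ≤ M`;
* `norm_lieTrotter_sub_exp_le`: the **Lie product formula with rate**,
  `‖(exp (a/N) exp (b/N))^N - exp (a + b)‖ ≤ 6 (‖a‖ + ‖b‖)² e^{5(‖a‖ + ‖b‖)} / N`;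
* `tendsto_lieTrotter`, `tendsto_lieTrotter_two_pow`: `(exp (a/N) exp (b/N))^N → exp (a + b)` as
  `N → ∞`, resp. along `N = 2^k`.

Sources: H. F. Trotter, Proc. AMS 10 (1959) 545; M. Reed, B. Simon, *Methods of Modern
Mathematical Physics I*, Theorem VIII.29 (the finite-dimensional / bounded case is the classical
Lie product formula, proved by exactly the telescoping estimate below).

## Mathlib search

Mathlib has `NormedSpace.exp` with `exp_add_of_commute`, `exp_nsmul`, the series
`exp_series_hasSum_exp'`, `expSeries_div_hasSum_exp`, `Real.exp_eq_exp_ℝ`, `norm_pow_le`,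
`HasSum.norm_le_of_bounded`; it has neither `‖exp a‖ ≤ e^{‖a‖}` in a general Banach algebra
(only `Complex.norm_exp_le_exp_norm`) nor the Lie–Trotter product formula
(`rg -i "trotter|lie product"` over Mathlib: nothing).

## Design notes

The scalar field `𝕂` (an `RCLike` field) is an explicit argument of the norm bounds whose
statements do not mention it, as in Mathlib's `NormedSpace.norm_expSeries_div_summable_of_mem_ball`.
The `1/N` scaling is written `(N : 𝕂)⁻¹ • a`.
-/

namespace Literature.MathematicalPhysics.QuantumLattice

open NormedSpace Filter Topology
open scoped Nat

/-! ### Norm bounds for the exponential series -/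

section NormBounds

variable {𝔸 : Type*} [NormedRing 𝔸] [NormOneClass 𝔸]

/-- Telescoping estimate for powers: if `‖X‖, ‖Y‖ ≤ M` then
`‖X^{N+1} - Y^{N+1}‖ ≤ (N + 1) M^N ‖X - Y‖`. Reed–Simon I, proof of Theorem VIII.29. [folklore] -/
theorem norm_pow_sub_pow_le' (X Y : 𝔸) {M : ℝ} (hX : ‖X‖ ≤ M) (hY : ‖Y‖ ≤ M)
    (N : ℕ) : ‖X ^ (N + 1) - Y ^ (N + 1)‖ ≤ (N + 1) * M ^ N * ‖X - Y‖ := by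
  have hM : 0 ≤ M := (norm_nonneg X).trans hX
  induction N with
  | zero => simp
  | succ N ih =>
    have hYN : ‖Y ^ (N + 1)‖ ≤ M ^ (N + 1) :=
      (norm_pow_le Y (N + 1)).trans (pow_le_pow_left₀ (norm_nonneg Y) hY (N + 1))
    have key : X ^ (N + 1 + 1) - Y ^ (N + 1 + 1) =
        X * (X ^ (N + 1) - Y ^ (N + 1)) + (X - Y) * Y ^ (N + 1) := by
      rw [pow_succ' X (N + 1), pow_succ' Y (N + 1)]
      noncomm_ring
    calc ‖X ^ (N + 1 + 1) - Y ^ (N + 1 + 1)‖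
        = ‖X * (X ^ (N + 1) - Y ^ (N + 1)) + (X - Y) * Y ^ (N + 1)‖ := by rw [key]
      _ ≤ ‖X‖ * ‖X ^ (N + 1) - Y ^ (N + 1)‖ + ‖X - Y‖ * ‖Y ^ (N + 1)‖ :=
          (norm_add_le _ _).trans (add_le_add (norm_mul_le _ _) (norm_mul_le _ _))
      _ ≤ M * ((N + 1) * M ^ N * ‖X - Y‖) + ‖X - Y‖ * M ^ (N + 1) := by
          gcongr
      _ = (↑(N + 1) + 1) * M ^ (N + 1) * ‖X - Y‖ := by push_cast; ring

variable (𝕂 : Type*) [RCLike 𝕂] [NormedAlgebra 𝕂 𝔸]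

/-- Termwise bound for the exponential series: `‖a^n / n!‖ ≤ ‖a‖^n / n!`. [folklore] -/
theorem norm_expSeries_term_le (a : 𝔸) (n : ℕ) :
    ‖(n !⁻¹ : 𝕂) • a ^ n‖ ≤ ‖a‖ ^ n / n ! := by
  rw [norm_smul, norm_inv, RCLike.norm_natCast, div_eq_inv_mul]
  gcongr
  exact norm_pow_le a n

variable [CompleteSpace 𝔸]

include 𝕂 in
/-- In a Banach algebra with `‖1‖ = 1`, `‖exp a‖ ≤ e^{‖a‖}` (comparison of the exponential
series with the real one). Reed–Simon I, §VIII.8. [folklore] -/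
theorem norm_exp_le (a : 𝔸) : ‖exp a‖ ≤ Real.exp ‖a‖ := by
  have h1 : HasSum (fun n => (n !⁻¹ : 𝕂) • a ^ n) (exp a) := exp_series_hasSum_exp' a
  have h2 : HasSum (fun n => ‖a‖ ^ n / n !) (Real.exp ‖a‖) := by
    rw [Real.exp_eq_exp_ℝ]
    exact expSeries_div_hasSum_exp ‖a‖
  exact h1.norm_le_of_bounded h2 (norm_expSeries_term_le 𝕂 a)

include 𝕂 in
/-- Second-order Taylor remainder of the exponential: `‖exp a - 1 - a‖ ≤ ‖a‖² e^{‖a‖}`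
(the tail `Σ_{n ≥ 2} a^n/n!` is dominated termwise by `‖a‖² Σ_n ‖a‖^n/n!`).
Reed–Simon I, §VIII.8. [folklore] -/
theorem norm_exp_sub_one_sub_le (a : 𝔸) :
    ‖exp a - 1 - a‖ ≤ ‖a‖ ^ 2 * Real.exp ‖a‖ := by
  have h1 : HasSum (fun n => (n !⁻¹ : 𝕂) • a ^ n) (exp a) := exp_series_hasSum_exp' a
  have h1' : HasSum (fun n => ((n + 2) !⁻¹ : 𝕂) • a ^ (n + 2)) (exp a - 1 - a) := by
    have h := (hasSum_nat_add_iff' 2).mpr h1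
    simp only [Finset.sum_range_succ, Finset.sum_range_zero, zero_add, Nat.factorial_zero,
      Nat.cast_one, inv_one, one_smul, pow_zero, Nat.factorial_one, pow_one] at h
    rwa [sub_sub]
  have h2 : HasSum (fun n => ‖a‖ ^ 2 * (‖a‖ ^ n / n !)) (‖a‖ ^ 2 * Real.exp ‖a‖) := by
    rw [Real.exp_eq_exp_ℝ]
    exact (expSeries_div_hasSum_exp ‖a‖).mul_left _
  refine h1'.norm_le_of_bounded h2 fun n => ?_
  calc ‖((n + 2) !⁻¹ : 𝕂) • a ^ (n + 2)‖
      ≤ ‖a‖ ^ (n + 2) / (n + 2) ! := by exact_mod_cast norm_expSeries_term_le 𝕂 a (n + 2)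
    _ ≤ ‖a‖ ^ (n + 2) / n ! := by
        exact div_le_div_of_nonneg_left (by positivity) (by positivity)
          (by exact_mod_cast Nat.factorial_le (Nat.le_add_right n 2))
    _ = ‖a‖ ^ 2 * (‖a‖ ^ n / n !) := by ring

include 𝕂 in
/-- One step of the Lie product formula:
`‖exp x exp y - exp (x + y)‖ ≤ 6 (‖x‖ + ‖y‖)² e^{4 (‖x‖ + ‖y‖)}`. Writing `exp z = 1 + z + R z`
with `‖R z‖ ≤ ‖z‖² e^{‖z‖}`, the difference is `x y + R y + x R y + R x (1 + y + R y) - R (x + y)`.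
Reed–Simon I, proof of Theorem VIII.29. [folklore] -/
theorem norm_exp_mul_exp_sub_exp_add_le (x y : 𝔸) :
    ‖exp x * exp y - exp (x + y)‖ ≤
      6 * (‖x‖ + ‖y‖) ^ 2 * Real.exp (4 * (‖x‖ + ‖y‖)) := by
  set s : ℝ := ‖x‖ + ‖y‖ with hs_def
  have hx : ‖x‖ ≤ s := by rw [hs_def]; linarith [norm_nonneg y]
  have hy : ‖y‖ ≤ s := by rw [hs_def]; linarith [norm_nonneg x]
  have hs0 : 0 ≤ s := (norm_nonneg x).trans hx
  have hxy : ‖x + y‖ ≤ s := norm_add_le x y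
  -- the remainders
  set Rx : 𝔸 := exp x - 1 - x with hRx_def
  set Ry : 𝔸 := exp y - 1 - y with hRy_def
  set Rxy : 𝔸 := exp (x + y) - 1 - (x + y) with hRxy_def
  have hE1 : 1 ≤ Real.exp s := Real.one_le_exp hs0
  have hR : ∀ z : 𝔸, ‖z‖ ≤ s → ‖exp z - 1 - z‖ ≤ s ^ 2 * Real.exp s := by
    intro z hz
    calc ‖exp z - 1 - z‖ ≤ ‖z‖ ^ 2 * Real.exp ‖z‖ := norm_exp_sub_one_sub_le 𝕂 z
      _ ≤ s ^ 2 * Real.exp s := by gcongr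
  have hRx : ‖Rx‖ ≤ s ^ 2 * Real.exp s := hR x hx
  have hRy : ‖Ry‖ ≤ s ^ 2 * Real.exp s := hR y hy
  have hRxy : ‖Rxy‖ ≤ s ^ 2 * Real.exp s := hR (x + y) hxy
  have key : exp x * exp y - exp (x + y) =
      x * y + Ry + x * Ry + Rx * (1 + y + Ry) - Rxy := by
    rw [hRx_def, hRy_def, hRxy_def]
    noncomm_ring
  -- elementary real bounds
  have hs_exp : s ≤ Real.exp s := by linarith [Real.add_one_le_exp s]
  have h2 : Real.exp s * Real.exp s = Real.exp (2 * s) := by rw [← Real.exp_add]; ring_nf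
  have h4 : Real.exp (2 * s) * Real.exp (2 * s) = Real.exp (4 * s) := by
    rw [← Real.exp_add]; ring_nf
  have hE2 : 1 ≤ Real.exp (2 * s) := Real.one_le_exp (by linarith)
  have hE14 : Real.exp s ≤ Real.exp (4 * s) := Real.exp_le_exp.mpr (by linarith)
  have hE24 : Real.exp (2 * s) ≤ Real.exp (4 * s) := Real.exp_le_exp.mpr (by linarith)
  have hE4 : 1 ≤ Real.exp (4 * s) := hE1.trans hE14
  -- (1 + s) e^s ≤ e^{2s}
  have h1s : (1 + s) * Real.exp s ≤ Real.exp (2 * s) := by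
    rw [← h2]
    gcongr
    linarith [Real.add_one_le_exp s]
  -- term bounds, each by `s² e^{4s}` (the fourth by `2 s² e^{4s}`)
  have T1 : ‖x * y‖ ≤ s ^ 2 * Real.exp (4 * s) :=
    calc ‖x * y‖ ≤ ‖x‖ * ‖y‖ := norm_mul_le _ _
      _ ≤ s * s := by gcongr
      _ = s ^ 2 * 1 := by ring
      _ ≤ s ^ 2 * Real.exp (4 * s) := by gcongr
  have T2 : ‖Ry‖ ≤ s ^ 2 * Real.exp (4 * s) := hRy.trans (by gcongr)
  have T3 : ‖x * Ry‖ ≤ s ^ 2 * Real.exp (4 * s) :=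
    calc ‖x * Ry‖ ≤ ‖x‖ * ‖Ry‖ := norm_mul_le _ _
      _ ≤ s * (s ^ 2 * Real.exp s) := by gcongr
      _ = s ^ 2 * (s * Real.exp s) := by ring
      _ ≤ s ^ 2 * (Real.exp s * Real.exp s) := by gcongr
      _ = s ^ 2 * Real.exp (2 * s) := by rw [h2]
      _ ≤ s ^ 2 * Real.exp (4 * s) := by gcongr
  have T4 : ‖Rx * (1 + y + Ry)‖ ≤ 2 * (s ^ 2 * Real.exp (4 * s)) :=
    calc ‖Rx * (1 + y + Ry)‖ ≤ ‖Rx‖ * ‖1 + y + Ry‖ := norm_mul_le _ _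
      _ ≤ ‖Rx‖ * (‖(1 : 𝔸)‖ + ‖y‖ + ‖Ry‖) := by
          gcongr
          exact norm_add₃_le
      _ ≤ (s ^ 2 * Real.exp s) * (1 + s + s ^ 2 * Real.exp s) := by
          rw [norm_one]
          gcongr
      _ = s ^ 2 * ((1 + s) * Real.exp s) + s ^ 2 * (s ^ 2 * (Real.exp s * Real.exp s)) := by
          ring
      _ ≤ s ^ 2 * Real.exp (2 * s) +
            s ^ 2 * ((Real.exp s * Real.exp s) * (Real.exp s * Real.exp s)) := by
          gcongr
          calc s ^ 2 = s * s := sq s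
            _ ≤ Real.exp s * Real.exp s := by gcongr
      _ = s ^ 2 * Real.exp (2 * s) + s ^ 2 * Real.exp (4 * s) := by
          rw [h2, h4]
      _ ≤ s ^ 2 * Real.exp (4 * s) + s ^ 2 * Real.exp (4 * s) := by gcongr
      _ = 2 * (s ^ 2 * Real.exp (4 * s)) := by ring
  have T5 : ‖Rxy‖ ≤ s ^ 2 * Real.exp (4 * s) := hRxy.trans (by gcongr)
  rw [key]
  calc ‖x * y + Ry + x * Ry + Rx * (1 + y + Ry) - Rxy‖
      ≤ ‖x * y‖ + ‖Ry‖ + ‖x * Ry‖ + ‖Rx * (1 + y + Ry)‖ + ‖Rxy‖ := by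
        have e1 := norm_sub_le (x * y + Ry + x * Ry + Rx * (1 + y + Ry)) Rxy
        have e2 := norm_add_le (x * y + Ry + x * Ry) (Rx * (1 + y + Ry))
        have e3 := norm_add₃_le (a := x * y) (b := Ry) (c := x * Ry)
        linarith
    _ ≤ s ^ 2 * Real.exp (4 * s) + s ^ 2 * Real.exp (4 * s) + s ^ 2 * Real.exp (4 * s) +
          2 * (s ^ 2 * Real.exp (4 * s)) + s ^ 2 * Real.exp (4 * s) := by
        gcongr
    _ = 6 * s ^ 2 * Real.exp (4 * s) := by ring

end NormBounds

/-! ### The Lie product formula -/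

section Trotter

variable {𝕂 𝔸 : Type*} [RCLike 𝕂] [NormedRing 𝔸] [NormedAlgebra 𝕂 𝔸]

/-- Norm of the scaled element: `‖N⁻¹ • a‖ ≤ ‖a‖ / N`. [folklore] -/
theorem norm_inv_natCast_smul_le (a : 𝔸) (N : ℕ) :
    ‖(N : 𝕂)⁻¹ • a‖ ≤ ‖a‖ / N := by
  rw [norm_smul, norm_inv, RCLike.norm_natCast, div_eq_inv_mul]

variable [NormOneClass 𝔸] [CompleteSpace 𝔸]

/-- **Lie product formula with rate.** In a Banach algebra with `‖1‖ = 1`, for `N ≥ 1`,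
`‖(exp (a/N) exp (b/N))^N - exp (a + b)‖ ≤ 6 (‖a‖ + ‖b‖)² e^{5 (‖a‖ + ‖b‖)} / N`.
Proof: with `X = exp (a/N) exp (b/N)`, `Y = exp ((a + b)/N)` one has `Y^N = exp (a + b)`,
`‖X‖, ‖Y‖ ≤ e^{(‖a‖ + ‖b‖)/N}`, `‖X - Y‖ ≤ 6 ((‖a‖ + ‖b‖)/N)² e^{4(‖a‖ + ‖b‖)}`, and the
telescoping estimate. Trotter, Proc. AMS 10 (1959) 545; Reed–Simon I, Theorem VIII.29.
[cite: ReedSimonI1980, Theorem VIII.29] -/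
theorem norm_lieTrotter_sub_exp_le (a b : 𝔸) {N : ℕ} (hN : N ≠ 0) :
    ‖(exp ((N : 𝕂)⁻¹ • a) * exp ((N : 𝕂)⁻¹ • b)) ^ N - exp (a + b)‖ ≤
      6 * (‖a‖ + ‖b‖) ^ 2 * Real.exp (5 * (‖a‖ + ‖b‖)) / N := by
  letI : NormedAlgebra ℚ 𝔸 := NormedAlgebra.restrictScalars ℚ 𝕂 𝔸
  obtain ⟨n, rfl⟩ : ∃ n, N = n + 1 := Nat.exists_eq_succ_of_ne_zero hN
  set r : ℝ := ‖a‖ + ‖b‖ with hr_def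
  have hr0 : 0 ≤ r := by positivity
  have hNpos : (0 : ℝ) < (n + 1 : ℕ) := by positivity
  set x : 𝔸 := ((n + 1 : ℕ) : 𝕂)⁻¹ • a with hx_def
  set y : 𝔸 := ((n + 1 : ℕ) : 𝕂)⁻¹ • b with hy_def
  have hxy : x + y = ((n + 1 : ℕ) : 𝕂)⁻¹ • (a + b) := by rw [hx_def, hy_def, smul_add]
  have hx : ‖x‖ ≤ ‖a‖ / (n + 1 : ℕ) := norm_inv_natCast_smul_le a (n + 1)
  have hy : ‖y‖ ≤ ‖b‖ / (n + 1 : ℕ) := norm_inv_natCast_smul_le b (n + 1)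
  have hs : ‖x‖ + ‖y‖ ≤ r / (n + 1 : ℕ) := by
    rw [hr_def, add_div]; exact add_le_add hx hy
  have hs' : ‖x‖ + ‖y‖ ≤ r := hs.trans (div_le_self hr0 (by exact_mod_cast Nat.succ_pos n))
  set X : 𝔸 := exp x * exp y with hX_def
  set Y : 𝔸 := exp (x + y) with hY_def
  -- `Y^N = exp (a + b)`
  have hYN : Y ^ (n + 1) = exp (a + b) := by
    rw [hY_def, ← exp_nsmul, hxy, ← Nat.cast_smul_eq_nsmul 𝕂, smul_smul,
      mul_inv_cancel₀ (by exact_mod_cast hN), one_smul]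
  -- norms of `X`, `Y`
  set M : ℝ := Real.exp (r / (n + 1 : ℕ)) with hM_def
  have hXM : ‖X‖ ≤ M :=
    calc ‖X‖ ≤ ‖exp x‖ * ‖exp y‖ := norm_mul_le _ _
      _ ≤ Real.exp ‖x‖ * Real.exp ‖y‖ :=
          mul_le_mul (norm_exp_le 𝕂 x) (norm_exp_le 𝕂 y) (norm_nonneg _) (Real.exp_nonneg _)
      _ = Real.exp (‖x‖ + ‖y‖) := (Real.exp_add _ _).symm
      _ ≤ M := Real.exp_le_exp.mpr hs
  have hYM : ‖Y‖ ≤ M :=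
    calc ‖Y‖ ≤ Real.exp ‖x + y‖ := norm_exp_le 𝕂 (x + y)
      _ ≤ Real.exp (‖x‖ + ‖y‖) := Real.exp_le_exp.mpr (norm_add_le x y)
      _ ≤ M := Real.exp_le_exp.mpr hs
  have hMn : M ^ n ≤ Real.exp r := by
    rw [hM_def, ← Real.exp_nat_mul]
    apply Real.exp_le_exp.mpr
    have h1 : (n : ℝ) * (r / (n + 1 : ℕ)) = r * (n / (n + 1 : ℕ)) := by ring
    rw [h1]
    apply mul_le_of_le_one_right hr0
    rw [div_le_one hNpos]
    exact_mod_cast Nat.le_succ n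
  -- the one-step estimate
  have hd : ‖X - Y‖ ≤ 6 * (r / (n + 1 : ℕ)) ^ 2 * Real.exp (4 * r) :=
    calc ‖X - Y‖ ≤ 6 * (‖x‖ + ‖y‖) ^ 2 * Real.exp (4 * (‖x‖ + ‖y‖)) :=
          norm_exp_mul_exp_sub_exp_add_le 𝕂 x y
      _ ≤ 6 * (r / (n + 1 : ℕ)) ^ 2 * Real.exp (4 * r) := by
          gcongr
  -- telescoping
  have htel := norm_pow_sub_pow_le' X Y hXM hYM n
  rw [hYN] at htel
  have h5 : Real.exp r * Real.exp (4 * r) = Real.exp (5 * r) := by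
    rw [← Real.exp_add]; ring_nf
  calc ‖X ^ (n + 1) - exp (a + b)‖ ≤ (n + 1) * M ^ n * ‖X - Y‖ := htel
    _ ≤ (n + 1) * Real.exp r * (6 * (r / (n + 1 : ℕ)) ^ 2 * Real.exp (4 * r)) := by
        gcongr
    _ = 6 * r ^ 2 * Real.exp (5 * r) / (n + 1 : ℕ) := by
        rw [← h5]
        field_simp
        push_cast
        ring

/-- **Lie product formula** (Trotter): `(exp (a/N) exp (b/N))^N → exp (a + b)` as `N → ∞`,
in any Banach algebra with `‖1‖ = 1`. Trotter, Proc. AMS 10 (1959) 545; Reed–Simon I,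
Theorem VIII.29. [cite: ReedSimonI1980, Theorem VIII.29] -/
theorem tendsto_lieTrotter (a b : 𝔸) :
    Tendsto (fun N : ℕ => (exp ((N : 𝕂)⁻¹ • a) * exp ((N : 𝕂)⁻¹ • b)) ^ N) atTop
      (𝓝 (exp (a + b))) := by
  set C : ℝ := 6 * (‖a‖ + ‖b‖) ^ 2 * Real.exp (5 * (‖a‖ + ‖b‖))
  rw [tendsto_iff_norm_sub_tendsto_zero]
  refine squeeze_zero_norm' ?_ (tendsto_const_div_atTop_nhds_zero_nat C)
  filter_upwards [eventually_ne_atTop 0] with N hN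
  rw [Real.norm_of_nonneg (norm_nonneg _)]
  exact norm_lieTrotter_sub_exp_le a b hN

/-- The Lie product formula along the powers of two, `N = 2^k` (the subsequence used with the
dyadic trace inequalities of Golden and Koma–Tasaki). Reed–Simon I, Theorem VIII.29.
[cite: ReedSimonI1980, Theorem VIII.29] -/
theorem tendsto_lieTrotter_two_pow (a b : 𝔸) :
    Tendsto (fun k : ℕ => (exp ((2 ^ k : 𝕂)⁻¹ • a) * exp ((2 ^ k : 𝕂)⁻¹ • b)) ^ 2 ^ k) atTop
      (𝓝 (exp (a + b))) := by
  have h := (tendsto_lieTrotter (𝕂 := 𝕂) a b).comp (tendsto_pow_atTop_atTop_of_one_lt one_lt_two)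
  refine h.congr fun k => ?_
  simp only [Function.comp_apply, Nat.cast_pow, Nat.cast_ofNat]

end Trotter

end Literature.MathematicalPhysics.QuantumLattice
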